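import Mathlib
import HarnessLib.Audit
import Summits.PneNP.PneNP.Theorems.PstarNorUnitDirection
import Summits.PneNP.PneNP.Theorems.PstarUnionCaseAEQ1
import Summits.PneNP.PneNP.Theorems.PstarUnionBridgeData
import Summits.PneNP.PneNP.Theorems.PstarUnionAtoms

/-!
# Case A of the union lemma has at most five outputs: `CaseAFive` (ROUND-24, memo §14.13 PC4–PC5 / §14.16–§14.20; ASK T-UNION-TRI (2))

FRONTIER range-avoidance ladder, rung F-N3, ROUND 24 (cell `pnp-ideate`, planner memo `r24/CORE-BOUND-NOTES.md` §14.13 (typed target `PstarUnionAtoms.CaseAFive` of planner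
p3 g22) and §14.16–§14.20 (CASE A MASTER PLAN); restricted-model proof complexity — nothing here bears on `P` versus `NP`).

**`caseAFive_holds : CaseAFive`.**  A union-terminal core (`PstarUnion.UnionTerminal`: pairs `(A₀, w₂)`, `(A₁, w₂)` unsolvable over `J₀`, every output releasing one of
them) with an admissible maximal peelable `F`, chords `J₀ ∖ F`, monomials off the chord privates (hun) and `w₂` chord-blind has `#J₀ ≤ 5`.

Proof = the direction picture of the terminal-core chain (`PstarNorUnitDirection.card_le_five_of_direction`) re-run for the union cover, in the read direction `m = (1,0)`
(`q_m = free₂ + b₂` is `w₂` on the cube; the readers read the privates, `w₂` does not):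

* the (★★) containment `Z(q) ⊆ {Q_{D c} = γ_c + 1}` is HARDNESS (`PstarUnionRankSixBridge.forced_of_cover`: `PstarChordSystem.star_star` in whichever of the two systems
  is chord-minimal at `c`), so `PstarForcing.forcing_cases` + `PstarNorUnitExcCore.exc_unit_core` give the per-chord trichotomy (EQ) / EXC-unit / (NOR) — `Z(q) ≠ ∅` by the
  cover at a chord;
* branches (a) "some chord (NOR)" and (b) "an EXC-unit" are the tree's STRUCTURAL counts (`PstarNorUnitFinal.card_le_five_of_regime_nor`, `not_EQ_of_nor_dir`,
  `false_of_nor_of_excUnit`, `D_eq_of_excUnits`, `J₀_eq_of_single`, `card_units_le_five_of_EQ_of_excUnit`, `subset_units`) — they use no minimality;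
* branch (c) "every chord (EQ)" is a single chord `e₀` (`chord_eq_of_EQ`), and the reader released at a forest output `j ∈ D e₀` runs `PstarUnionCaseAEQ1.eq1_caseA` on its own
  bridge data: `#J₀ = 3`.

`card_le_five_caseA` is the bridge-level statement (hypotheses of `PstarUnionRankSixEmpty.caseA_empty_of_kernel_trivial` plus expansion, XOR-closure, peelability, `N ≠ ∅`);
`caseAFive_holds` feeds it with `PstarUnionBridgeData.exists_union_bridgeData`.  `CaseATrichotomy` and the general `UnionFive` (Case B: `w₂` reads a chord literal) remain open.
-/

set_option linter.dupNamespace false -- `Summit.PneNP.PneNP.…`: summit = sub-problem name (D-0017 single-conjunct layout)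

open Finset Module Literature.Computability.Complexity
open scoped symmDiff
open Summit.PneNP.PneNP.Theorems.PstarFibrePolys (bit bit_injective)
open Summit.PneNP.PneNP.Theorems.PstarTyped (Typed)
open Summit.PneNP.PneNP.Theorems.PstarSALevel (varSet bdry BoundaryExpanding SimpleOverlap)
open Summit.PneNP.PneNP.Theorems.PstarCoreBound (XorClosed)
open Summit.PneNP.PneNP.Theorems.PstarGapLinearised (andPair)
open Summit.PneNP.PneNP.Theorems.PstarGapOneAll (gval)
open Summit.PneNP.PneNP.Theorems.PstarXCore (xverts)
open Summit.PneNP.PneNP.Theorems.PstarCubeIdeals (IsAffineFn)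
open Summit.PneNP.PneNP.Theorems.PstarProductRank (qform polar)
open Summit.PneNP.PneNP.Theorems.PstarPathRank (AndAdj)
open Summit.PneNP.PneNP.Theorems.PstarForcing (forcing_cases)
open Summit.PneNP.PneNP.Theorems.PstarChordRepair (IsChord)
open Summit.PneNP.PneNP.Theorems.PstarChordBridgeTools (xpdeg privs vars_mem_privs uval free coef bit_gval_eq)
open Summit.PneNP.PneNP.Theorems.PstarChordBridge (BridgeData sys Solution Lift sys_u)
open Summit.PneNP.PneNP.Theorems.PstarReadSumset (V2)
open Summit.PneNP.PneNP.Theorems.PstarChordBridgeFundamental (eq_of_fundamental_eq two_le_card_of_even)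
open Summit.PneNP.PneNP.Theorems.PstarChordBridgeForcing (gam sys_u_eq qform_add' rank_four_of_wf chord_eq_of_EQ coef_of_unread)
open Summit.PneNP.PneNP.Theorems.PstarChordBridgeCotree (Peelable sdiff_nonempty_of_xorClosed)
open Summit.PneNP.PneNP.Theorems.PstarChordBridgeTerminal (HasConstraints)
open Summit.PneNP.PneNP.Theorems.PstarChordBridgeBasis (qDir polarDir)
open Summit.PneNP.PneNP.Theorems.PstarChordBridgeCorner (qDir_add)
open Summit.PneNP.PneNP.Theorems.PstarNorUnitExcCore (exc_unit_core)
open Summit.PneNP.PneNP.Theorems.PstarNorUnitMixed (false_of_nor_of_excUnit D_eq_of_excUnits card_units_le_five_of_EQ_of_excUnit)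
open Summit.PneNP.PneNP.Theorems.PstarNorUnitDirAssembly (xorClosed_units not_EQ_of_nor_dir)
open Summit.PneNP.PneNP.Theorems.PstarNorUnitCoverTools (two_le_xpdeg_of_xorClosed)
open Summit.PneNP.PneNP.Theorems.PstarNorUnitCover (subset_units)
open Summit.PneNP.PneNP.Theorems.PstarNorUnitFinal (card_le_five_of_regime_nor)
open Summit.PneNP.PneNP.Theorems.PstarNorUnitRegime (J₀_eq_of_single)
open Summit.PneNP.PneNP.Theorems.PstarUnion (SatPair UnionTerminal)
open Summit.PneNP.PneNP.Theorems.PstarUnionAtoms (CaseAFive)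
open Summit.PneNP.PneNP.Theorems.PstarUnionRankSixBridge (wf_update forced_of_cover)
open Summit.PneNP.PneNP.Theorems.PstarUnionCaseAEQ1 (qDir_one_zero eq1_caseA)
open Summit.PneNP.PneNP.Theorems.PstarUnionBridgeData (exists_union_bridgeData)

namespace Summit.PneNP.PneNP.Theorems.PstarUnionCaseAFive

variable {n m : ℕ}

/-- In `𝔽₂`, `x + x = 0`. -/
private theorem zmod2_add_self (x : ZMod 2) : x + x = 0 := by
  revert x; decide

/-- In `𝔽₂`, `s + t = 0 ↔ s = t`. -/
private theorem zmod2_add_eq_zero_iff (s t : ZMod 2) : s + t = 0 ↔ s = t := by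
  revert s t; decide

/-- **A solution of the forest with `w₂` is a zero of `q`**: `free₂(bit ∘ z) = b₂` (hun, `w₂` blind). -/
theorem free₂_eq_of_solution (I : LocalMap 4 n m) (hI : I.IsPure xorAndPred) (hT : Typed I) {B : BridgeData n m} (hW : B.WF I)
    (hun₂ : ∀ v ∈ privs I B.N, ∀ g ∈ B.G₂, I.vars g 2 ≠ v ∧ I.vars g 3 ≠ v) (hblind : ∀ v ∈ privs I B.N, v ∉ B.C₂)
    {z : Fin n → Bool} (hz : ∀ j ∈ B.J₀ \ B.N, I.eval z j = B.y j) (hzw : gval I B.C₂ B.G₂ z = B.b₂) :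
    free I B.y (B.J₀ \ B.N) B.N B.T₂ B.C₂ B.G₂ (fun v => bit (z v)) = bit B.b₂ := by
  have h := bit_gval_eq I hI hT hW.hN hW.hchord B.y hW.hT₂ B.C₂ B.G₂ hW.hjoin₂ hW.hcross₂ hz
  rw [hzw, sum_eq_zero fun e he => ?_, add_zero] at h
  · exact h.symm
  · rw [coef_of_unread I (hun₂ _ (vars_mem_privs I he (s := 2) (by decide))), if_neg (hblind _ (vars_mem_privs I he (s := 2) (by decide))),
      coef_of_unread I (hun₂ _ (vars_mem_privs I he (s := 3) (by decide))), if_neg (hblind _ (vars_mem_privs I he (s := 3) (by decide))),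
      mul_zero, mul_zero, add_zero]

/-- **Case A at bridge level: `#J₀ ≤ 5`.**  Hypotheses: those of `PstarUnionRankSixEmpty.caseA_empty_of_kernel_trivial` (union configuration of well-formed liftable bridge data, hun,
`w₂` blind, (T3) twice, union cover) without the kernel, plus the structural ones of the direction picture (`(r,3/2)`-expansion, `#J₀ < r`, `#(J₀ ∪ G₁ ∪ G₂) ≤ r`, XOR-closed
core, peelable `J₀ ∖ N`, `N ≠ ∅`). -/
theorem card_le_five_caseA (I : LocalMap 4 n m) (hI : I.IsPure xorAndPred) (hT : Typed I) (hS : SimpleOverlap I) {r : ℕ}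
    (hB : BoundaryExpanding r I) {B : BridgeData n m} (hW : B.WF I) (hJr : B.J₀.card < r) (hr : (B.J₀ ∪ B.G₁ ∪ B.G₂).card ≤ r)
    (hX : XorClosed I B.J₀) (hP : Peelable I (B.J₀ \ B.N)) (hG₁ : Disjoint B.G₁ B.J₀) (hG₂ : Disjoint B.G₂ B.J₀) (hN : B.N.Nonempty)
    (hL : Lift I B) {C₁' : Finset (Fin n)} {b₁' : Bool} (hC : ∀ v ∈ B.C₁ ∆ C₁', v ∉ xverts I (B.J₀ \ B.N))
    (hun : ∀ v ∈ privs I B.N, (∀ g ∈ B.G₁, I.vars g 2 ≠ v ∧ I.vars g 3 ≠ v) ∧ ∀ g ∈ B.G₂, I.vars g 2 ≠ v ∧ I.vars g 3 ≠ v)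
    (hblind : ∀ v ∈ privs I B.N, v ∉ B.C₂)
    (hT3 : ¬ ∃ z, Solution I B B.J₀ z) (hT3' : ¬ ∃ z, Solution I { B with C₁ := C₁', b₁ := b₁' } B.J₀ z)
    (hM0 : ∀ f ∈ B.J₀, (∃ z, Solution I B (B.J₀.erase f) z) ∨ (∃ z, Solution I { B with C₁ := C₁', b₁ := b₁' } (B.J₀.erase f) z)) :
    B.J₀.card ≤ 5 := by
  classical
  have e1 : ∀ g Q : ZMod 2, g + Q = 1 → Q = g + 1 := by decide
  set mv : V2 := ((1 : ZMod 2), (0 : ZMod 2)) with hmv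
  have hW' : ({ B with C₁ := C₁', b₁ := b₁' } : BridgeData n m).WF I := wf_update hW b₁' hC
  -- hardness: every chord is forced on `Z(q)`
  have hforced : ∀ e ∈ B.N, ∀ a, free I B.y (B.J₀ \ B.N) B.N B.T₂ B.C₂ B.G₂ a = bit B.b₂ → uval I B.y (B.D e) e a = 1 :=
    fun e he a ha => forced_of_cover I hI hT hW hL hC hun hblind hT3 hT3' hM0 he ha
  have hZc : ∀ e ∈ B.N, ∀ x, qDir I B mv x = 0 → qform (B.D e) (fun j => I.vars j 2) (fun j => I.vars j 3) x = gam B e + 1 := by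
    intro e he x hx
    rw [hmv, qDir_one_zero] at hx
    have h := hforced e he x ((zmod2_add_eq_zero_iff _ _).1 hx)
    have hu := sys_u_eq I B e x
    rw [sys_u] at hu
    rw [hu] at h
    exact e1 _ _ h
  -- `Z(q) ≠ ∅`: the cover at a chord gives a forest solution with `w₂`
  have hZne : ∃ a, free I B.y (B.J₀ \ B.N) B.N B.T₂ B.C₂ B.G₂ a = bit B.b₂ := by
    obtain ⟨c, hc⟩ := hN
    have hsub : B.J₀ \ B.N ⊆ B.J₀.erase c := fun j hj => mem_erase.2 ⟨fun h => (mem_sdiff.1 hj).2 (h ▸ hc), (mem_sdiff.1 hj).1⟩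
    rcases hM0 c (hW.hN hc) with ⟨z, hzK, -, hz2⟩ | ⟨z, hzK, -, hz2⟩
    · exact ⟨_, free₂_eq_of_solution I hI hT hW (fun v hv => (hun v hv).2) hblind (fun j hj => hzK j (hsub hj)) hz2⟩
    · exact ⟨_, free₂_eq_of_solution I hI hT hW (fun v hv => (hun v hv).2) hblind (fun j hj => hzK j (hsub hj)) hz2⟩
  obtain ⟨a₀, ha₀⟩ := hZne
  have hq0 : qDir I B mv a₀ = 0 := by rw [hmv, qDir_one_zero, ha₀]; exact zmod2_add_self _
  have heG : ∀ e ∈ B.N, e ∉ B.G₁ ∪ B.G₂ := fun e he h => by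
    rcases mem_union.1 h with h | h
    · exact Finset.disjoint_left.1 hG₁ h (hW.hN he)
    · exact Finset.disjoint_left.1 hG₂ h (hW.hN he)
  have hqB : ∀ x w, qDir I B mv (x + w) = qDir I B mv x + qDir I B mv w + qDir I B mv 0 + polarDir I B mv x w := qDir_add I B mv
  -- per chord: (EQ) / EXC-unit / (NOR)
  have hcls : ∀ e ∈ B.N,
      (∃ κ : ZMod 2, ∀ x, qform (B.D e) (fun j => I.vars j 2) (fun j => I.vars j 3) x = qDir I B mv x + κ) ∨
      (∃ j₁ j₂ : Fin m, ∃ σ τ : Fin n, j₁ ≠ j₂ ∧ B.D e = {j₁, j₂} ∧ Disjoint (andPair I j₁) (andPair I j₂) ∧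
        σ ∈ andPair I j₁ ∧ τ ∈ andPair I j₂ ∧
        ∀ v w : Fin n, polarDir I B mv (Pi.single v 1) (Pi.single w 1) =
          (if AndAdj I (B.D e) v w then 1 else 0) + (if (v = σ ∧ w = τ) ∨ (v = τ ∧ w = σ) then 1 else 0)) ∨
      (∃ a b : Fin n → ZMod 2, polarDir I B mv a b = 1 ∧
        (∀ x, qDir I B mv x =
          (polarDir I B mv x b + (qDir I B mv b + qDir I B mv 0)) * (polarDir I B mv x a + (qDir I B mv a + qDir I B mv 0)) + 1) ∧
        ∃ m₁ m₂ : (Fin n → ZMod 2) → ZMod 2, IsAffineFn m₁ ∧ IsAffineFn m₂ ∧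
          ∀ x, qform (B.D e) (fun j => I.vars j 2) (fun j => I.vars j 3) x + (gam B e + 1) =
            (polarDir I B mv x b + (qDir I B mv b + qDir I B mv 0) + 1) * m₁ x +
            (polarDir I B mv x a + (qDir I B mv a + qDir I B mv 0) + 1) * m₂ x) := by
    intro e he
    rcases forcing_cases hqB (qform_add' I (B.D e)) (rank_four_of_wf I hI hS hB hW hJr.le he) (hZc e he) with
        h1 | h | ⟨ν₁, ν₂, hν₁, hν₂, κ, h⟩ | h
    · exact absurd (h1 a₀) (by rw [hq0]; exact zero_ne_one)
    · exact Or.inl h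
    · rcases exc_unit_core I hI hS hB hW hr he (heG e he) mv hqB (hZc e he) hν₁ hν₂ h with h' | ⟨j₁, j₂, σ, τ, hne, hDe, hdisj, hσ, hτ, -, hform, -⟩
      · exact Or.inl h'
      · exact Or.inr (Or.inl ⟨j₁, j₂, σ, τ, hne, hDe, hdisj, hσ, hτ, hform⟩)
    · exact Or.inr (Or.inr h)
  -- (a) some (NOR) chord ⟹ every chord (NOR)
  by_cases hNOR : ∃ e ∈ B.N, ∃ a b : Fin n → ZMod 2, polarDir I B mv a b = 1 ∧
      (∀ x, qDir I B mv x =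
        (polarDir I B mv x b + (qDir I B mv b + qDir I B mv 0)) * (polarDir I B mv x a + (qDir I B mv a + qDir I B mv 0)) + 1) ∧
      ∃ m₁ m₂ : (Fin n → ZMod 2) → ZMod 2, IsAffineFn m₁ ∧ IsAffineFn m₂ ∧
        ∀ x, qform (B.D e) (fun j => I.vars j 2) (fun j => I.vars j 3) x + (gam B e + 1) =
          (polarDir I B mv x b + (qDir I B mv b + qDir I B mv 0) + 1) * m₁ x +
          (polarDir I B mv x a + (qDir I B mv a + qDir I B mv 0) + 1) * m₂ x
  · obtain ⟨e₁, he₁, a₁, b₁, -, hq₁, -⟩ := hNOR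
    refine card_le_five_of_regime_nor I hI hT hS hB hW hr hJr hX hP hG₁ hG₂ hN mv fun e he => ?_
    rcases hcls e he with ⟨κ, hκ⟩ | ⟨j₁, j₂, σ, τ, -, hDe, hdisj, hσ, hτ, hform⟩ | h
    · exact (not_EQ_of_nor_dir I hI hS hB hW hJr.le mv hq₁ he hκ).elim
    · exact (false_of_nor_of_excUnit I hI hDe hdisj hσ hτ hform hq₁).elim
    · exact h
  -- (b) no (NOR) chord, some EXC-unit `e`
  by_cases hUNIT : ∃ e ∈ B.N, ∃ j₁ j₂ : Fin m, ∃ σ τ : Fin n, j₁ ≠ j₂ ∧ B.D e = {j₁, j₂} ∧ Disjoint (andPair I j₁) (andPair I j₂) ∧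
      σ ∈ andPair I j₁ ∧ τ ∈ andPair I j₂ ∧
      ∀ v w : Fin n, polarDir I B mv (Pi.single v 1) (Pi.single w 1) =
        (if AndAdj I (B.D e) v w then 1 else 0) + (if (v = σ ∧ w = τ) ∨ (v = τ ∧ w = σ) then 1 else 0)
  · obtain ⟨e, he, j₁, j₂, σ, τ, hne, hDe, hdisj, hσ, hτ, hform⟩ := hUNIT
    have heD : e ∉ B.D e := fun h => (mem_sdiff.1 (hW.hD e he h)).2 he
    have hother : ∀ e' ∈ B.N, e' ≠ e →
        ∃ κ : ZMod 2, ∀ x, qform (B.D e') (fun j => I.vars j 2) (fun j => I.vars j 3) x = qDir I B mv x + κ := by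
      intro e' he' hne'
      rcases hcls e' he' with h | ⟨k₁, k₂, σ', τ', hne'', hDe', hdisj', hσ', hτ', hform'⟩ | h
      · exact h
      · exfalso
        have hDD : B.D e' = B.D e := D_eq_of_excUnits I hI hS hDe hdisj hσ hτ hform hne'' hDe' hdisj' hσ' hτ' hform'
        have he'D : e' ∉ B.D e := fun h => (mem_sdiff.1 (hW.hD e' he' (hDD ▸ h))).2 he'
        have heven' : ∀ w, Even (xpdeg I (insert e' (B.D e)) w) := fun w => by
          have h := hW.hDeven e' he' w
          rwa [hDD] at h
        exact hne' (eq_of_fundamental_eq I hI hS he'D heD heven' (hW.hDeven e he))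
      · exact absurd ⟨e', he', h⟩ hNOR
    by_cases hsingle : ∀ e' ∈ B.N, e' = e
    · have hNe : B.N = {e} := eq_singleton_iff_unique_mem.2 ⟨he, hsingle⟩
      have h3 : B.J₀.card = 3 := by
        rw [J₀_eq_of_single I hI hT hW hX hP hNe, card_insert_of_notMem heD, hDe, card_pair hne]
      omega
    · push Not at hsingle
      obtain ⟨e', he', hne'⟩ := hsingle
      obtain ⟨κ', hκ'⟩ := hother e' he' hne'
      have hNe : B.N = {e, e'} := by
        refine Subset.antisymm (fun f hf => ?_) fun f hf => ?_
        · rw [mem_insert, mem_singleton]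
          by_cases hfe : f = e
          · exact Or.inl hfe
          · obtain ⟨κf, hκf⟩ := hother f hf hfe
            exact Or.inr (chord_eq_of_EQ I hI hS hW hf he' hκf hκ')
        · rw [mem_insert, mem_singleton] at hf
          rcases hf with rfl | rfl
          · exact he
          · exact he'
      have h5 := card_units_le_five_of_EQ_of_excUnit I hI hS hDe hdisj hσ hτ hform hqB hκ' hNe
      exact le_trans (card_le_card (subset_units I hI hS hW.hN hP hW.hD hW.hDeven (two_le_xpdeg_of_xorClosed I hT hX)
        (two_le_xpdeg_of_xorClosed I hT (xorClosed_units I hI hW)) h5)) h5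
  -- (c) every chord (EQ): a single chord; the reader released at a forest output of its cycle runs `eq1_caseA`
  have hEQ : ∀ e ∈ B.N, ∃ κ : ZMod 2, ∀ x, qform (B.D e) (fun j => I.vars j 2) (fun j => I.vars j 3) x = qDir I B mv x + κ := by
    intro e he
    rcases hcls e he with h | h | h
    · exact h
    · exact absurd ⟨e, he, h⟩ hUNIT
    · exact absurd ⟨e, he, h⟩ hNOR
  obtain ⟨e₁, he₁⟩ := hN
  obtain ⟨κ₁, hκ₁⟩ := hEQ e₁ he₁
  have hNe : B.N = {e₁} := by
    refine eq_singleton_iff_unique_mem.2 ⟨he₁, fun e he => ?_⟩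
    obtain ⟨κ, hκ⟩ := hEQ e he
    exact chord_eq_of_EQ I hI hS hW he he₁ hκ hκ₁
  have he₁D : e₁ ∉ B.D e₁ := fun h => (mem_sdiff.1 (hW.hD e₁ he₁ h)).2 he₁
  have hD2 : 2 ≤ (B.D e₁).card := two_le_card_of_even I hI hS he₁D (hW.hDeven e₁ he₁)
  obtain ⟨j, hj⟩ : (B.D e₁).Nonempty := card_pos.1 (by omega)
  have hjJ : j ∈ B.J₀ := (mem_sdiff.1 (hW.hD e₁ he₁ hj)).1
  have hforced0 : ∀ e ∈ B.N, ∀ a, free I B.y (B.J₀ \ B.N) B.N B.T₂ B.C₂ B.G₂ a = bit B.b₂ → uval I B.y (B.D e) e a = 1 := hforced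
  rcases hM0 j hjJ with ⟨z, hz⟩ | ⟨z, hz⟩
  · have h3 := eq1_caseA I hI hT hS hB hW hr hX hP hG₁ hG₂ hL hun hblind hT3 hforced ⟨a₀, ha₀⟩ hNe (by rw [hmv] at hκ₁; exact hκ₁) hj hz
    omega
  · have hκ₁' : ∀ x, qform (B.D e₁) (fun j => I.vars j 2) (fun j => I.vars j 3) x =
        qDir I ({ B with C₁ := C₁', b₁ := b₁' } : BridgeData n m) ((1 : ZMod 2), (0 : ZMod 2)) x + κ₁ := fun x => by
      rw [qDir_one_zero]
      have h := hκ₁ x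
      rw [hmv, qDir_one_zero] at h
      exact h
    have h3 := eq1_caseA I hI hT hS hB hW' hr hX hP hG₁ hG₂ hL hun hblind hT3' hforced0 ⟨a₀, ha₀⟩ hNe hκ₁' hj hz
    have h3' : B.J₀.card = 3 := h3
    omega

/-- **`CaseAFive` holds**: Case A of the union lemma — union-terminal core, admissible `F`, hun, `w₂` chord-blind ⟹ `#J₀ ≤ 5`. -/
theorem caseAFive_holds : CaseAFive := by
  classical
  intro n m r I hI hT hS hB y J₀ A₀ A₁ w₂ hU F hF hP hmax hchord hun hblind
  have hX : XorClosed I J₀ := hU.2.1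
  have hJr : J₀.card < r := hU.2.2.1
  have hG : A₁.2.1 = A₀.2.1 := hU.2.2.2.1
  have hcard : (J₀ ∪ A₀.2.1 ∪ w₂.2.1).card ≤ r := hU.2.2.2.2.2.2.1
  obtain ⟨B, R, R', hRR', hy, hJ, hN, ⟨hC1, hG1, hb1, hC2, hG2, hb2⟩, hW, hL, -, hD₁, hD₂, hne, hR'G, hC, hunB, hT3, hT3', hM0⟩ :=
    exists_union_bridgeData I hI hT hS hB hU hF hP hmax hchord hun
  have hFN : J₀ \ (J₀ \ F) = F := Finset.sdiff_sdiff_eq_self hF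
  have hRG : R.2.1 = A₀.2.1 := by
    rcases hRR' with ⟨h, -⟩ | ⟨h, -⟩
    · rw [h]
    · rw [h, hG]
  have hJr' : B.J₀.card < r := by rw [hJ]; exact hJr
  have hr' : (B.J₀ ∪ B.G₁ ∪ B.G₂).card ≤ r := by rw [hJ, hG1, hG2, hRG]; exact hcard
  have hX' : XorClosed I B.J₀ := by rw [hJ]; exact hX
  have hP' : Peelable I (B.J₀ \ B.N) := by rw [hJ, hN, hFN]; exact hP
  have hN' : B.N.Nonempty := by rw [hN]; exact sdiff_nonempty_of_xorClosed I hT hX hU.1 hF hP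
  have hblind' : ∀ v ∈ privs I B.N, v ∉ B.C₂ := by rw [hN, hC2]; exact hblind
  have h := card_le_five_caseA I hI hT hS hB hW hJr' hr' hX' hP' hD₁ hD₂ hN' hL hC hunB hblind' hT3 hT3' hM0
  rw [hJ] at h
  exact h

end Summit.PneNP.PneNP.Theorems.PstarUnionCaseAFive
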